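import Literature.MathematicalPhysics.QuantumLattice.OverlapLocality
import Literature.MathematicalPhysics.QuantumLattice.MobilityGap
import Literature.MathematicalPhysics.QuantumLattice.LatticeToriProofs
import Literature.MathematicalPhysics.QuantumLattice.LinkHopCommutators

/-!
# The Wilson–Dirac matrix has range one: off-site entry bounds, row and column sums

Topic `Literature/MathematicalPhysics/QuantumLattice`; namespace `Literature.MathematicalPhysics.QuantumLattice`.
Everything here is PROVED (no definitions, no named facts).

For a unitary representation `ρ : G →* U(N)`, every gauge field `U` on the periodic lattice
`(ℤ/L)⁴`, every bare mass `m` and Wilson parameter `r = 1`, the matrix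
`D_W = wilsonDirac ρ U m 1` on `TorusSite 4 L × Fin N × Fin 4` ([Wilson1975]; [MontvayMunster1994,
§4.2 (4.85)]) is a nearest-neighbour operator whose off-site part is uniformly bounded in `U` and
`m`:

* `norm_wilsonDirac_apply_le_of_ne` — off the diagonal an entry is a sum of at most one forward and
  one backward hop per direction, each of modulus `≤ ½ · |(1 ∓ γ_μ)_{αβ}| · |ρ(U)_{ab}| ≤ 1`:
  `|D_{pq}| ≤ Σ_μ (𝟙[q = p + μ̂] + 𝟙[p = q + μ̂])` (site components);
* RANGE ONE: a nonzero entry joins equal or nearest-neighbour sites, in the periodic `ℓ^∞`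
  distance (`torusDist_le_one_of_wilsonDirac_ne_zero`) and in the periodic `ℓ¹` / taxi distance
  (`torusTaxiDist_le_one_of_wilsonDirac_ne_zero`, via `torusNormOne_single_le_one`);
* the absolute row and column sums over OFF-SITE entries are at most `32 N`
  (`wilsonDirac_offsite_rowSum_le`, `wilsonDirac_offsite_colSum_le`; `96` for `SU(3)` quarks),
  with the corollaries filtered by `torusDist ≠ 0` / `torusTaxiDist ≠ 0` that the Combes–Thomas
  lemmas of `Literature/Analysis/Matrix/QuadraticCombesThomas.lean` consume
  (`wilsonDirac_rowSum_torusDist_le`, `…_colSum_torusDist_le`, `…_rowSum_torusTaxiDist_le`,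
  `…_colSum_torusTaxiDist_le`).

Valid on every torus `L ≥ 1` (for `L ≤ 2` forward and backward hops may coincide or land on-site;
only absolute values are summed and on-site entries are excluded).  Versions of these facts were
previously proved inside Summits-side theorem files, which `Literature` cannot import:
privately in `Theorems/HeatSlicedQuarksRobustYangMillsHandoverStubHighBlockLocality.lean` (`SU(3)`,
`ℓ^∞`) and `Theorems/SpectralDefectExtinctionExtinctionBuildsQCDCleanRefStubCombesThomasWilson.lean`,
and publicly (general `ρ`, general `r`, FULL row sums `≤ |m + 4r| + 16N(|r|+1)` including the
diagonal) in `Theorems/HeatSlicedQuarksDaviesGaffneyWilsonRange.lean`.  What is recorded here once,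
for a general unitary `ρ` at `r = 1`, is the MASS-INDEPENDENT off-site version (the shape the
Combes–Thomas conjugation needs: the diagonal carries the mass and drops out of the perturbation)
together with the taxi-distance range statement, so that locality estimates for `D_W⁻¹`,
`(D_WᴴD_W + λ)⁻¹`, heat kernels etc. written under `Literature/` can import them.
-/

noncomputable section

namespace Literature.MathematicalPhysics.QuantumLattice

open Matrix Finset
open Literature.Probability.LatticeModels (TorusSite)
open Literature.MathematicalPhysics.QuantumFieldTheory

/-! ### Entries of the spin matrices -/

/-- Entries of the Euclidean gamma matrices have modulus `≤ 1` (`γ_μ` is unitary: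
`γ_μᴴ γ_μ = γ_μ² = 1`). [folklore] -/
theorem norm_euclideanGamma_apply_le (μ : Fin 4) (α β : Fin 4) : ‖euclideanGamma μ α β‖ ≤ 1 := by
  refine entry_norm_bound_of_unitary (Matrix.mem_unitaryGroup_iff'.mpr ?_) α β
  rw [Matrix.star_eq_conjTranspose, (euclideanGamma_isHermitian μ).eq, euclideanGamma_mul_self]

/-- Entries of `1 ∓ γ_μ` (the `r = 1` Wilson spin projectors times `2`) have modulus `≤ 2`. [folklore] -/
theorem norm_one_sub_add_euclideanGamma_apply_le (μ : Fin 4) (α β : Fin 4) :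
    ‖(((1 : ℝ) : ℂ) • (1 : Matrix (Fin 4) (Fin 4) ℂ) - euclideanGamma μ) α β‖ ≤ 2 ∧
      ‖(((1 : ℝ) : ℂ) • (1 : Matrix (Fin 4) (Fin 4) ℂ) + euclideanGamma μ) α β‖ ≤ 2 := by
  have h1 : ‖(1 : Matrix (Fin 4) (Fin 4) ℂ) α β‖ ≤ 1 := by
    rw [Matrix.one_apply]; split_ifs <;> simp
  have h2 := norm_euclideanGamma_apply_le μ α β
  simp only [Complex.ofReal_one, one_smul, Matrix.sub_apply, Matrix.add_apply]
  exact ⟨(norm_sub_le _ _).trans (by linarith), (norm_add_le _ _).trans (by linarith)⟩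

/-! ### The periodic `ℓ¹` norm of a unit vector -/

/-- `‖μ̂‖₁ ≤ 1` on the periodic lattice `(ℤ/L)^d` (equality unless `L = 1`). [folklore] -/
theorem torusNormOne_single_le_one {d L : ℕ} [NeZero L] (μ : Fin d) :
    torusNormOne (Ls := fun _ : Fin d => L) (Pi.single μ (1 : ZMod L)) ≤ 1 := by
  unfold torusNormOne
  rw [Finset.sum_eq_single μ]
  · rw [Pi.single_eq_same]; exact cyclicAbs_one_le
  · intro i _ hi
    rw [Pi.single_eq_of_ne hi, ZMod.val_zero, Nat.zero_min]
  · exact fun h => absurd (Finset.mem_univ μ) h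

/-- `‖(y + μ̂) − y‖₁ ≤ 1`: nearest neighbours are at taxi distance `≤ 1`. [folklore] -/
theorem torusTaxiDist_add_single_le_one {d L : ℕ} [NeZero L] (y : TorusSite d L) (μ : Fin d) :
    torusTaxiDist (y + Pi.single μ 1) y ≤ 1 := by
  have h : torusTaxiDist (y + Pi.single μ 1) y =
      torusNormOne (Ls := fun _ : Fin d => L) (Pi.single μ (1 : ZMod L)) := by
    show torusDistOne (Ls := fun _ : Fin d => L) (y + Pi.single μ 1) y = _
    rw [torusDistOne, add_sub_cancel_left]
  rw [h]
  exact torusNormOne_single_le_one μ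

/-! ### Off-site entries of the Wilson–Dirac matrix -/

section Wilson

variable {L N : ℕ} {G : Type*} [Group G] (ρ : G →* Matrix (Fin N) (Fin N) ℂ)

/-- **Off-site entries of `D_W` are hops of modulus `≤ 1`.**  For unitary `ρ`, every gauge field,
every mass and `r = 1`: if `p ≠ q` then
`|D_W p q| ≤ Σ_μ (𝟙[q.1 = p.1 + μ̂] + 𝟙[p.1 = q.1 + μ̂])`.
[cite: MontvayMunster1994, §4.2 (4.85) (Wilson–Dirac operator)] -/
theorem norm_wilsonDirac_apply_le_of_ne (hρ : ∀ g, ρ g ∈ Matrix.unitaryGroup (Fin N) ℂ)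
    (U : GaugeConfig 4 L G) (m : ℝ) {p q : TorusSite 4 L × Fin N × Fin 4} (hpq : p ≠ q) :
    ‖wilsonDirac ρ U m 1 p q‖ ≤
      ∑ μ : Fin 4, ((if q.1 = Site.shift p.1 μ then (1 : ℝ) else 0) +
        (if p.1 = Site.shift q.1 μ then (1 : ℝ) else 0)) := by
  have hU : ∀ g : G, ∀ a b : Fin N, ‖ρ g a b‖ ≤ 1 := fun g a b =>
    entry_norm_bound_of_unitary (hρ g) a b
  simp only [wilsonDirac, Matrix.of_apply, if_neg hpq, zero_sub, norm_neg, norm_mul]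
  have hhalf : ‖(1 / 2 : ℂ)‖ = 1 / 2 := by norm_num
  rw [hhalf]
  have hterm : ∀ μ : Fin 4,
      ‖(if q.1 = Site.shift p.1 μ then
            (((1 : ℝ) : ℂ) • (1 : Matrix (Fin 4) (Fin 4) ℂ) - euclideanGamma μ) p.2.2 q.2.2 *
              ρ (U (p.1, μ)) p.2.1 q.2.1 else 0) +
          (if p.1 = Site.shift q.1 μ then
            (((1 : ℝ) : ℂ) • (1 : Matrix (Fin 4) (Fin 4) ℂ) + euclideanGamma μ) p.2.2 q.2.2 *
              ρ (U (q.1, μ))⁻¹ p.2.1 q.2.1 else 0)‖ ≤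
        2 * ((if q.1 = Site.shift p.1 μ then (1 : ℝ) else 0) +
          (if p.1 = Site.shift q.1 μ then (1 : ℝ) else 0)) := by
    intro μ
    obtain ⟨hm, hp⟩ := norm_one_sub_add_euclideanGamma_apply_le μ p.2.2 q.2.2
    refine (norm_add_le _ _).trans ?_
    rw [mul_add]
    refine add_le_add ?_ ?_
    · split_ifs with hc
      · rw [norm_mul]
        calc _ ≤ 2 * 1 := mul_le_mul hm (hU _ _ _) (norm_nonneg _) zero_le_two
          _ = 2 * 1 := rfl
      · simp
    · split_ifs with hc
      · rw [norm_mul]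
        calc _ ≤ 2 * 1 := mul_le_mul hp (hU _ _ _) (norm_nonneg _) zero_le_two
          _ = 2 * 1 := rfl
      · simp
  calc 1 / 2 * ‖∑ μ : Fin 4, _‖ ≤ 1 / 2 * ∑ μ : Fin 4,
        2 * ((if q.1 = Site.shift p.1 μ then (1 : ℝ) else 0) +
          (if p.1 = Site.shift q.1 μ then (1 : ℝ) else 0)) := by
        refine mul_le_mul_of_nonneg_left
          ((norm_sum_le _ _).trans (Finset.sum_le_sum fun μ _ => hterm μ)) ?_
        norm_num
    _ = _ := by rw [← Finset.mul_sum]; ring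

/-- **Off-site entries vanish beyond nearest neighbours**: if `p.1 ≠ q.1` and `q.1` is neither
`p.1 + μ̂` nor `p.1 − μ̂` for any `μ`, then `D_W p q = 0`. [cite: MontvayMunster1994, §4.2 (4.85) (Wilson–Dirac operator)] -/
theorem wilsonDirac_apply_eq_zero_of_not_adj (hρ : ∀ g, ρ g ∈ Matrix.unitaryGroup (Fin N) ℂ)
    (U : GaugeConfig 4 L G) (m : ℝ) {p q : TorusSite 4 L × Fin N × Fin 4} (hpq : p ≠ q)
    (h1 : ∀ μ : Fin 4, q.1 ≠ Site.shift p.1 μ) (h2 : ∀ μ : Fin 4, p.1 ≠ Site.shift q.1 μ) :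
    wilsonDirac ρ U m 1 p q = 0 := by
  have hle := norm_wilsonDirac_apply_le_of_ne ρ hρ U m hpq
  simp only [if_neg (h1 _), if_neg (h2 _), add_zero, Finset.sum_const_zero] at hle
  exact norm_le_zero_iff.mp hle

variable [NeZero L]

/-- **Range one in the periodic `ℓ^∞` distance**: `D_W p q ≠ 0 → torusDist p.1 q.1 ≤ 1`. [folklore] -/
theorem torusDist_le_one_of_wilsonDirac_ne_zero (hρ : ∀ g, ρ g ∈ Matrix.unitaryGroup (Fin N) ℂ)
    (U : GaugeConfig 4 L G) (m : ℝ) (p q : TorusSite 4 L × Fin N × Fin 4)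
    (h : wilsonDirac ρ U m 1 p q ≠ 0) : torusDist p.1 q.1 ≤ 1 := by
  by_contra hd
  rw [not_le] at hd
  have hpq : p ≠ q := by
    rintro rfl
    rw [torusDist_self] at hd
    exact Nat.not_succ_le_zero 1 hd
  refine h (wilsonDirac_apply_eq_zero_of_not_adj ρ hρ U m hpq (fun μ hq => ?_) (fun μ hp => ?_))
  · have := torusDist_add_single_le_one p.1 μ
    rw [torusDist_comm', ← Literature.MathematicalPhysics.QuantumFieldTheory.Site.shift, ← hq] at this
    omega
  · have := torusDist_add_single_le_one q.1 μ
    rw [← Literature.MathematicalPhysics.QuantumFieldTheory.Site.shift, ← hp] at this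
    omega

/-- **Range one in the periodic taxi (`ℓ¹`) distance**: `D_W p q ≠ 0 → torusTaxiDist p.1 q.1 ≤ 1`.
[cite: HernandezJansenLuscher1999, §3.1 (ultralocality of the Wilson operator)] -/
theorem torusTaxiDist_le_one_of_wilsonDirac_ne_zero (hρ : ∀ g, ρ g ∈ Matrix.unitaryGroup (Fin N) ℂ)
    (U : GaugeConfig 4 L G) (m : ℝ) (p q : TorusSite 4 L × Fin N × Fin 4)
    (h : wilsonDirac ρ U m 1 p q ≠ 0) : torusTaxiDist p.1 q.1 ≤ 1 := by
  by_contra hd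
  rw [not_le] at hd
  have hpq : p ≠ q := by
    rintro rfl
    rw [torusTaxiDist_self] at hd
    exact Nat.not_succ_le_zero 1 hd
  refine h (wilsonDirac_apply_eq_zero_of_not_adj ρ hρ U m hpq (fun μ hq => ?_) (fun μ hp => ?_))
  · have := torusTaxiDist_add_single_le_one p.1 μ
    rw [torusTaxiDist_comm, ← Literature.MathematicalPhysics.QuantumFieldTheory.Site.shift, ← hq] at this
    omega
  · have := torusTaxiDist_add_single_le_one q.1 μ
    rw [← Literature.MathematicalPhysics.QuantumFieldTheory.Site.shift, ← hp] at this
    omega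

/-- Counting: `#{(y, b, β) | y = s} = 4N`. [folklore] -/
theorem sum_ite_fst_eq_card (s : TorusSite 4 L) :
    ∑ q : TorusSite 4 L × Fin N × Fin 4, (if q.1 = s then (1 : ℝ) else 0) = 4 * N := by
  rw [Fintype.sum_prod_type, Finset.sum_eq_single s (fun y _ hy => by simp [hy]) (by simp)]
  simp only [if_true, Finset.sum_const, Finset.card_univ, Fintype.card_prod, Fintype.card_fin,
    nsmul_eq_mul, mul_one]
  push_cast
  ring

/-- **Off-site row sums**: for every predicate `P` excluding the site-diagonal (`P q → p.1 ≠ q.1`),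
`Σ_{q : P q} |D_W p q| ≤ 32 N`. [folklore] -/
theorem wilsonDirac_offsite_rowSum_le (hρ : ∀ g, ρ g ∈ Matrix.unitaryGroup (Fin N) ℂ)
    (U : GaugeConfig 4 L G) (m : ℝ) (p : TorusSite 4 L × Fin N × Fin 4)
    (P : TorusSite 4 L × Fin N × Fin 4 → Prop) [DecidablePred P] (hP : ∀ q, P q → p.1 ≠ q.1) :
    ∑ q ∈ univ.filter P, ‖wilsonDirac ρ U m 1 p q‖ ≤ 32 * N := by
  calc _ ≤ ∑ q ∈ univ.filter P,
        ∑ μ : Fin 4, ((if q.1 = Site.shift p.1 μ then (1 : ℝ) else 0) +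
          (if p.1 = Site.shift q.1 μ then (1 : ℝ) else 0)) := by
        refine Finset.sum_le_sum fun q hq => norm_wilsonDirac_apply_le_of_ne ρ hρ U m ?_
        rintro rfl
        exact hP p (Finset.mem_filter.mp hq).2 rfl
    _ ≤ ∑ q : TorusSite 4 L × Fin N × Fin 4,
        ∑ μ : Fin 4, ((if q.1 = Site.shift p.1 μ then (1 : ℝ) else 0) +
          (if p.1 = Site.shift q.1 μ then (1 : ℝ) else 0)) :=
        Finset.sum_le_univ_sum_of_nonneg fun q => Finset.sum_nonneg fun μ _ => by positivity
    _ = ∑ _μ : Fin 4, ((4 * N : ℝ) + 4 * N) := by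
        rw [Finset.sum_comm]
        refine Finset.sum_congr rfl fun μ _ => ?_
        rw [Finset.sum_add_distrib, sum_ite_fst_eq_card]
        simp_rw [eq_shift_iff p.1 _ μ]
        rw [sum_ite_fst_eq_card]
    _ = 32 * N := by simp only [Finset.sum_const, Finset.card_univ, Fintype.card_fin, nsmul_eq_mul]; ring

/-- **Off-site column sums**: for every predicate `P` excluding the site-diagonal
(`P p → p.1 ≠ q.1`), `Σ_{p : P p} |D_W p q| ≤ 32 N`. [folklore] -/
theorem wilsonDirac_offsite_colSum_le (hρ : ∀ g, ρ g ∈ Matrix.unitaryGroup (Fin N) ℂ)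
    (U : GaugeConfig 4 L G) (m : ℝ) (q : TorusSite 4 L × Fin N × Fin 4)
    (P : TorusSite 4 L × Fin N × Fin 4 → Prop) [DecidablePred P] (hP : ∀ p, P p → p.1 ≠ q.1) :
    ∑ p ∈ univ.filter P, ‖wilsonDirac ρ U m 1 p q‖ ≤ 32 * N := by
  calc _ ≤ ∑ p ∈ univ.filter P,
        ∑ μ : Fin 4, ((if q.1 = Site.shift p.1 μ then (1 : ℝ) else 0) +
          (if p.1 = Site.shift q.1 μ then (1 : ℝ) else 0)) := by
        refine Finset.sum_le_sum fun p hp => norm_wilsonDirac_apply_le_of_ne ρ hρ U m ?_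
        rintro rfl
        exact hP p (Finset.mem_filter.mp hp).2 rfl
    _ ≤ ∑ p : TorusSite 4 L × Fin N × Fin 4,
        ∑ μ : Fin 4, ((if q.1 = Site.shift p.1 μ then (1 : ℝ) else 0) +
          (if p.1 = Site.shift q.1 μ then (1 : ℝ) else 0)) :=
        Finset.sum_le_univ_sum_of_nonneg fun p => Finset.sum_nonneg fun μ _ => by positivity
    _ = ∑ _μ : Fin 4, ((4 * N : ℝ) + 4 * N) := by
        rw [Finset.sum_comm]
        refine Finset.sum_congr rfl fun μ _ => ?_
        rw [Finset.sum_add_distrib, sum_ite_fst_eq_card]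
        simp_rw [eq_shift_iff q.1 _ μ]
        rw [sum_ite_fst_eq_card]
    _ = 32 * N := by simp only [Finset.sum_const, Finset.card_univ, Fintype.card_fin, nsmul_eq_mul]; ring

/-- Row sums over `{q | torusDist p.1 q.1 ≠ 0}` are `≤ 32 N` (the shape consumed by
`Literature.Analysis.Matrix.quadratic_combes_thomas` with `dist p q := torusDist p.1 q.1`). [folklore] -/
theorem wilsonDirac_rowSum_torusDist_le (hρ : ∀ g, ρ g ∈ Matrix.unitaryGroup (Fin N) ℂ)
    (U : GaugeConfig 4 L G) (m : ℝ) (p : TorusSite 4 L × Fin N × Fin 4) :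
    ∑ q ∈ univ.filter (fun q : TorusSite 4 L × Fin N × Fin 4 => torusDist p.1 q.1 ≠ 0),
      ‖wilsonDirac ρ U m 1 p q‖ ≤ 32 * N :=
  wilsonDirac_offsite_rowSum_le ρ hρ U m p _ fun q hq h => hq (by rw [h, torusDist_self])

/-- Column sums over `{p | torusDist p.1 q.1 ≠ 0}` are `≤ 32 N`. [folklore] -/
theorem wilsonDirac_colSum_torusDist_le (hρ : ∀ g, ρ g ∈ Matrix.unitaryGroup (Fin N) ℂ)
    (U : GaugeConfig 4 L G) (m : ℝ) (q : TorusSite 4 L × Fin N × Fin 4) :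
    ∑ p ∈ univ.filter (fun p : TorusSite 4 L × Fin N × Fin 4 => torusDist p.1 q.1 ≠ 0),
      ‖wilsonDirac ρ U m 1 p q‖ ≤ 32 * N :=
  wilsonDirac_offsite_colSum_le ρ hρ U m q _ fun p hp h => hp (by rw [h, torusDist_self])

/-- Row sums over `{q | torusTaxiDist p.1 q.1 ≠ 0}` are `≤ 32 N` (for Combes–Thomas with the taxi
distance). [folklore] -/
theorem wilsonDirac_rowSum_torusTaxiDist_le (hρ : ∀ g, ρ g ∈ Matrix.unitaryGroup (Fin N) ℂ)
    (U : GaugeConfig 4 L G) (m : ℝ) (p : TorusSite 4 L × Fin N × Fin 4) :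
    ∑ q ∈ univ.filter (fun q : TorusSite 4 L × Fin N × Fin 4 => torusTaxiDist p.1 q.1 ≠ 0),
      ‖wilsonDirac ρ U m 1 p q‖ ≤ 32 * N :=
  wilsonDirac_offsite_rowSum_le ρ hρ U m p _ fun q hq h => hq (by rw [h, torusTaxiDist_self])

/-- Column sums over `{p | torusTaxiDist p.1 q.1 ≠ 0}` are `≤ 32 N`. [folklore] -/
theorem wilsonDirac_colSum_torusTaxiDist_le (hρ : ∀ g, ρ g ∈ Matrix.unitaryGroup (Fin N) ℂ)
    (U : GaugeConfig 4 L G) (m : ℝ) (q : TorusSite 4 L × Fin N × Fin 4) :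
    ∑ p ∈ univ.filter (fun p : TorusSite 4 L × Fin N × Fin 4 => torusTaxiDist p.1 q.1 ≠ 0),
      ‖wilsonDirac ρ U m 1 p q‖ ≤ 32 * N :=
  wilsonDirac_offsite_colSum_le ρ hρ U m q _ fun p hp h => hp (by rw [h, torusTaxiDist_self])

end Wilson

end Literature.MathematicalPhysics.QuantumLattice

end
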